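import Mathlib
import HarnessLib
import Literature.Probability.Percolation.Percolation
import Literature.Probability.Percolation.TwoPointFunction
import Literature.Probability.Percolation.CriticalContinuity

/-!
# `TetrahedronLogConvexity` (stmt-CriticalPhenomena-7801), line `Sketch` (card `mirror-certificate-vigour`,
# certificate form) — definitions: the mirror-symmetric two-seed certificate and its hybrid functionals

The objects the line posits (registered skeleton `Cruxes/TetrahedronLogConvexity/Lines/Sketch.lean`), in the
vocabulary of `Literature.Probability.Percolation` (`bondPercolation`, `openGraph`, `openConn`,
`criticalProbI`) and Mathlib (`SimpleGraph.edist`, product measures):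

* `vA r, vB r, vC r` — the vertices `a_r = (r,r,0)`, `b_r = (r,0,r)`, `c_r = (0,r,r)` of the regular lattice
  tetrahedron `T_r = {0, a_r, b_r, c_r}`; the reflection `(x₀ x₁)` of `ℤ³` fixes `0, a_r` and swaps `b_r, c_r`;
* `latOpen ω` — the open nearest-neighbour subgraph of `ℤ³`; `NR r R ω = min(⌈d_ω(0,a_r)/2⌉, R)` — the
  truncated merge layer of the layer-synchronous two-seed breadth-first exploration from `{0, a_r}`;
  `AR r R = {NR < R}` — "merged before the truncation"; `explored r R ω` — the examined edges (all lattice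
  edges incident to a vertex at open distance `< NR` from a seed), a finite subset of `edgeWindow r R`;
* `hyb r R (ω, ω')` — the hybrid configuration (certificate of `ω`, continuation `ω'`);
* `Qb, Qbc, Qbb` — the one- and two-continuation capture functionals
  `P⊗P{A_R, 0↔b in hyb}`, `P⊗P⊗P{A_R, 0↔b in hyb', 0↔c in hyb''}`, `P⊗P⊗P{A_R, 0↔b in hyb', 0↔b in hyb''}`
  (`= E[1_{A_R} m₊]`, `E[1_{A_R} m₊m₋]`, `E[1_{A_R} m₊²]` for the launching powers `m±` of the certificate).

Nothing here asserts anything about the crux. Source of the construction: crux idea card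
`Cruxes/TetrahedronLogConvexity/Ideas/mirror-certificate-vigour.md` (stopping-set form); the hybrid of two
copies along an exploration is Gladkov's device (arXiv:2408.08457, Lemma 3.1).
-/

noncomputable section

open MeasureTheory Filter
open Literature.Probability.Percolation Literature.Probability.LatticeModels

namespace Summit.CriticalPhenomena.PercolationContinuityZ3.Theorems.TetrahedronLogConvexity.Cert

/-- `a_r = (r, r, 0)`. [folklore] -/
def vA (r : ℕ) : Site 3 := ![(r : ℤ), (r : ℤ), 0]
/-- `b_r = (r, 0, r)`. [folklore] -/
def vB (r : ℕ) : Site 3 := ![(r : ℤ), 0, (r : ℤ)]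
/-- `c_r = (0, r, r)`. [folklore] -/
def vC (r : ℕ) : Site 3 := ![0, (r : ℤ), (r : ℤ)]

/-- The critical bond measure on `ℤ³`. [folklore] -/
abbrev Pc : Measure (BondConfig (Site 3)) := bondPercolation (zdGraph 3) (criticalProbI 3)

/-- The open LATTICE graph of `ω`: nearest-neighbour edges of `ℤ³` that are open in `ω` (pairs of `ω`
that are not lattice edges are ignored; `P_p`-a.s. there are none, `ae_subset_edgeSet`). Using it
makes the exploration below a stopping set for EVERY configuration. [folklore] -/
def latOpen (ω : BondConfig (Site 3)) : SimpleGraph (Site 3) := zdGraph 3 ⊓ openGraph ω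

open Classical in
/-- Truncated merge layer `NR r R ω = min(⌈d_ω(0,a_r)/2⌉, R)`: the least `n` with
`d_ω(0,a_r) ≤ 2n` or `n = R` (`d_ω` = graph distance in the open lattice graph of `ω`). [folklore] -/
def NR (r R : ℕ) (ω : BondConfig (Site 3)) : ℕ :=
  Nat.find (⟨R, Or.inr rfl⟩ : ∃ n : ℕ, (latOpen ω).edist 0 (vA r) ≤ 2 * (n : ℕ∞) ∨ n = R)

/-- `A_R = {NR < R}`: the two explorations merge strictly before the truncation layer
(equivalently `d_ω(0,a_r) ≤ 2R - 2`); `A_R ↑ {0 ↔ a_r}`. [folklore] -/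
def AR (r R : ℕ) : Set (BondConfig (Site 3)) := {ω | NR r R ω < R}

open Classical in
/-- The finite window of lattice edges that a truncated exploration can examine: edges of `ℤ³`
with both endpoints in the box `Λ(R + r + 1)`. [folklore] -/
def edgeWindow (r R : ℕ) : Finset (Sym2 (Site 3)) :=
  ((box 3 (R + r + 1)).sym2).filter (fun e => e ∈ (zdGraph 3).edgeSet)

open Classical in
/-- The examined edges of the truncated layer-synchronous two-seed exploration: all lattice edges
incident to a vertex at open-graph distance `< NR` from `0` or from `a_r`. [folklore] -/
def explored (r R : ℕ) (ω : BondConfig (Site 3)) : Finset (Sym2 (Site 3)) :=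
  (edgeWindow r R).filter (fun e => ∃ x ∈ e,
    (latOpen ω).edist 0 x < (NR r R ω : ℕ∞) ∨ (latOpen ω).edist (vA r) x < (NR r R ω : ℕ∞))

/-- The hybrid configuration: the certificate of `ω` (its states on the examined edges) continued
by `ω'` on all other edges. [folklore] -/
def hyb (r R : ℕ) (x : BondConfig (Site 3) × BondConfig (Site 3)) : BondConfig (Site 3) :=
  (x.1 ∩ ↑(explored r R x.1)) ∪ (x.2 \ ↑(explored r R x.1))

/-- `Qb = P⊗P{ω ∈ A_R, 0 ↔ b_r in hyb(ω,ω')}` (`= E[1_{A_R} m₊] = P(A_R, 0 ↔ b_r)`). [folklore] -/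
def Qb (r R : ℕ) : ℝ :=
  (Pc.prod Pc).real {x | x.1 ∈ AR r R ∧ hyb r R x ∈ openConn 0 (vB r)}

/-- `Qbc = P⊗P⊗P{ω ∈ A_R, 0 ↔ b_r in hyb(ω,ω'), 0 ↔ c_r in hyb(ω,ω'')}` (`= E[1_{A_R} m₊ m₋]`). [folklore] -/
def Qbc (r R : ℕ) : ℝ :=
  (Pc.prod (Pc.prod Pc)).real {x | x.1 ∈ AR r R ∧ hyb r R (x.1, x.2.1) ∈ openConn 0 (vB r) ∧
    hyb r R (x.1, x.2.2) ∈ openConn 0 (vC r)}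

/-- `Qbb = P⊗P⊗P{ω ∈ A_R, 0 ↔ b_r in hyb(ω,ω'), 0 ↔ b_r in hyb(ω,ω'')}` (`= E[1_{A_R} m₊²]`). [folklore] -/
def Qbb (r R : ℕ) : ℝ :=
  (Pc.prod (Pc.prod Pc)).real {x | x.1 ∈ AR r R ∧ hyb r R (x.1, x.2.1) ∈ openConn 0 (vB r) ∧
    hyb r R (x.1, x.2.2) ∈ openConn 0 (vB r)}

/-! ## Elementary facts every user needs -/

/-- `NR ≤ R` (the witness `n = R` of the defining `Nat.find`). [folklore] -/
theorem NR_le (r R : ℕ) (ω : BondConfig (Site 3)) : NR r R ω ≤ R := by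
  classical
  unfold NR
  exact Nat.find_le (Or.inr rfl)

/-- Membership in `A_R`, unfolded. [folklore] -/
theorem mem_AR_iff {r R : ℕ} {ω : BondConfig (Site 3)} : ω ∈ AR r R ↔ NR r R ω < R := Iff.rfl

/-- The examined edges lie in the finite window. [folklore] -/
theorem explored_subset_edgeWindow (r R : ℕ) (ω : BondConfig (Site 3)) : explored r R ω ⊆ edgeWindow r R := by
  classical
  unfold explored
  exact Finset.filter_subset _ _

/-- The open lattice graph is a subgraph of the open graph. [folklore] -/
theorem latOpen_le_openGraph (ω : BondConfig (Site 3)) : latOpen ω ≤ openGraph ω := inf_le_right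

/-- The open lattice graph is a subgraph of `ℤ³`. [folklore] -/
theorem latOpen_le_zdGraph (ω : BondConfig (Site 3)) : latOpen ω ≤ zdGraph 3 := inf_le_left

/-- The hybrid agrees with the certificate on the examined edges and with the continuation elsewhere. [folklore] -/
theorem mem_hyb_iff {r R : ℕ} {x : BondConfig (Site 3) × BondConfig (Site 3)} {e : Sym2 (Site 3)} :
    e ∈ hyb r R x ↔ (e ∈ x.1 ∧ e ∈ explored r R x.1) ∨ (e ∈ x.2 ∧ e ∉ explored r R x.1) := by
  simp [hyb]

end Summit.CriticalPhenomena.PercolationContinuityZ3.Theorems.TetrahedronLogConvexity.Cert
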